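import Summits.NavierStokesRegularity.NavierStokesRegularity.Theorems.ExtremiserTransienceNearExtremalTransiencePerFlowMemberSelectionZoomRegularity
import Literature.Analysis.FluidPDE.KNSSLocalSmoothingHolds
import HarnessLib

/-!
# Route `ExtremiserTransience`, items `RegularisedSliceTransfer` (stmt-NavierStokesRegularity-28318) and
# `NearExtremalTransiencePerFlow` (stmt-NavierStokesRegularity-26567): ALL-ORDER TYPE-I RATES of a Type-I classical flow
# (= statement T1 `HigherTypeIRates` of LINE g6-β «regularised transfer», `Cruxes/NearExtremalTransiencePerFlow/Lines/regularised_transfer.lean` §1)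

`--supports stmt-NavierStokesRegularity-28318` (helper: step (T1) of the item's plan; the same text was registered on 26567 as stub
`stub_higherTypeIRates` of LINE g6-β and is consumed by LINE g8-α `sparse_bangbang` (S-T) and by the zone/bang-bang lines of crux 26567).

THE STATEMENT (`higherTypeIRates`, verbatim T1).  A classical Navier–Stokes flow on `[0,T) × ℝ³` (viscosity `ν`), Leray–Hopf from a rapidly
decaying datum, with an EVENTUAL Type-I rate `√(T−t)‖u(t)‖_∞ ≤ C√ν`, obeys ALL-ORDER Type-I rates with one onset:
`‖∇ʲu(t, x)‖ ≤ C_j · (√ν/√(T−t)) · (√(ν(T−t)))^{−j}` for all `j`, all `x`, and all `t` close to `T` — the parabolic bootstrap at the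
Type-I scale (folklore; KNSS 2009 Prop. 4.1 (4.6)).  No singularity hypothesis is needed.

THE PROOF (parabolic zoom + the landed uniform window form of KNSS Prop. 4.1).  For a late time `t` let `λ = √(ν(T−t))` and zoom with
unit viscosity about `(t, 0)`: `w(s, y) = (λ/ν)·u(t + (T−t)s, λy)` (`zoom_isClassical_window`, Oseen identity `zoom_oseen_window` on the
window `s ∈ (−t/(T−t), 1)`).  On `s ∈ [−1/2, 1/2]` the physical times lie in `[t − (T−t)/2, t + (T−t)/2]`, inside the Type-I zone once
`t > (2T₁+T)/3`, and `T − t' ≥ (T−t)/2`, so `‖w‖ ≤ (λ/ν)·C√ν·√2/√(T−t) = C√2` — a bound INDEPENDENT of `t`.  The landed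
`ExtremiserTransience.iteratedFDeriv_bound_of_oseenWindow k` (seat ns-net-p2; KNSS Prop. 4.1 clamped to drift-mild windows) then bounds
`‖∇ᵏ w(0)‖ ≤ Λ_k` with `Λ_k = Λ(k, C√2, 1, 1/2)`; unzooming (`u(t, x) = (ν/λ)·w(0, x/λ)`, hypothesis-free scaling identities
`iteratedFDeriv_const_smul_real`, `norm_iteratedFDeriv_comp_smul_le`) gives `‖∇ᵏu(t)‖ ≤ Λ_k (ν/λ) λ^{−k}`, i.e. the claim with `C_k = Λ_k`.
HONEST FRAMING: regularity bookkeeping for (hypothetical) Type-I flows; nothing about Navier–Stokes regularity or blow-up is proved here;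
no summit is proved by a line.  Author: prover seat `ns-net-p1` (g2). [cite: KochNadirashviliSereginSverak2009, Prop. 4.1 (4.6) (arXiv:0709.3599 §4 p. 8)]
-/

noncomputable section

open scoped Topology
open Filter Set MeasureTheory Function Metric
open Literature.Analysis Literature.Analysis.FluidPDE Literature.Analysis.UnboundedOperators

namespace Summit.NavierStokesRegularity.NavierStokesRegularity.Theorems.ExtremiserTransience

-- the problem directory repeats the summit name (`NavierStokesRegularity/NavierStokesRegularity`)
set_option linter.dupNamespace false

/-- **All-order Type-I rates (T1 `HigherTypeIRates` of LINE g6-β, verbatim).**  For a classical Leray–Hopf flow on `[0,T) × ℝ³` from a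
rapidly decaying datum with an eventual Type-I rate `√(T−t)‖u(t)‖_∞ ≤ C√ν` there are constants `Cs j` such that, for all `t` close to
`T`, all orders `j` and all `x`, `‖iteratedFDeriv ℝ j (u t) x‖ ≤ Cs j · (√ν/√(T−t)) · (√(ν(T−t)))⁻¹ ^ j`.
[cite: KochNadirashviliSereginSverak2009, Prop. 4.1 (4.6) (arXiv:0709.3599 §4 p. 8)] -/
theorem higherTypeIRates : ∀ (C ν T : ℝ), 0 < C → 0 < ν → 0 < T →
    ∀ (u : ℝ → EuclideanSpace ℝ (Fin 3) → EuclideanSpace ℝ (Fin 3)) (p : ℝ → EuclideanSpace ℝ (Fin 3) → ℝ),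
    Literature.Analysis.FluidPDE.IsClassicalNSSolutionOn (Set.Ico 0 T) ν 0 u p →
    Literature.Analysis.FluidPDE.IsLerayHopfOn T ν 0 (u 0) u →
    Literature.Analysis.FluidPDE.HasRapidSpatialDecay (u 0) →
    (∀ᶠ t in 𝓝[<] T, ∀ x, Real.sqrt (T - t) * ‖u t x‖ ≤ C * Real.sqrt ν) →
    (∃ Cs : ℕ → ℝ, ∀ᶠ t in 𝓝[<] T, ∀ (j : ℕ) (x : EuclideanSpace ℝ (Fin 3)),
      ‖iteratedFDeriv ℝ j (u t) x‖ ≤ Cs j * (Real.sqrt ν / Real.sqrt (T - t)) * (Real.sqrt (ν * (T - t)))⁻¹ ^ j) := by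
  intro C ν T hC hν hT u p hsol hLH hdec hrate
  have hsν : 0 < Real.sqrt ν := Real.sqrt_pos.2 hν
  -- the eventual Type-I rate on `(t⋆, T)`; slab bounds on `[0, T₁]` (needed by the Oseen identity of the zoom)
  obtain ⟨tstar, htstar, hsub⟩ := mem_nhdsLT_iff_exists_Ioo_subset.1 hrate
  have htstarT : tstar < T := htstar
  set T₁ : ℝ := max ((tstar + T) / 2) (T / 2) with hT₁def
  have hT₁T : T₁ < T := max_lt (by linarith [htstarT]) (by linarith)
  have hT₁0 : 0 < T₁ := lt_of_lt_of_le (by linarith) (le_max_right _ _)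
  have hT₁2 : T / 2 ≤ T₁ := le_max_right _ _
  have hT₁star : tstar < T₁ := lt_of_lt_of_le (by linarith [htstarT]) (le_max_left _ _)
  have hbdd : ∀ T₂ ∈ Ioo 0 T, ∃ M : ℝ, ∀ t ∈ Icc 0 T₂, ∀ y, ‖u t y‖ ≤ M :=
    exists_forall_norm_le_of_tao2011 tao2011_hasBoundedSobolevNormsOn_holds hν hsol hLH hdec
  have htypeI : ∀ t' : ℝ, T₁ < t' → t' < T → ∀ x, ‖u t' x‖ ≤ C * Real.sqrt ν / Real.sqrt (T - t') := by
    intro t' h1 h2 x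
    have h := hsub ⟨hT₁star.trans h1, h2⟩ x
    rw [le_div_iff₀ (Real.sqrt_pos.2 (sub_pos.2 h2)), mul_comm]
    exact h
  -- the uniform window constants: bound `N = C√2` on zoom times `[−1/2, 1/2]`, window `[0,1]`, interior time `1/2`
  set N : ℝ := C * Real.sqrt 2 with hNdef
  have hN0 : 0 ≤ N := by positivity
  have h12 : (0 : ℝ) < 1 / 2 := by norm_num
  have h121 : (1 : ℝ) / 2 < 1 := by norm_num
  have hwin := fun k : ℕ => iteratedFDeriv_bound_of_oseenWindow k hN0 h12 h121
  choose Λ hΛ0 hΛ using hwin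
  -- onset: `t > T₂ = (2T₁ + T)/3`, so that the physical window `[t − (T−t)/2, t + (T−t)/2]` lies inside `(T₁, T)`
  set T₂ : ℝ := (2 * T₁ + T) / 3 with hT₂def
  have hT₂T : T₂ < T := by rw [hT₂def]; linarith
  refine ⟨Λ, Filter.eventually_of_mem (Ioo_mem_nhdsLT hT₂T) fun t ht j x => ?_⟩
  have htT : t < T := ht.2
  have hTt : 0 < T - t := sub_pos.2 htT
  have htT₁ : T₁ < t - (T - t) / 2 := by have := ht.1; rw [hT₂def] at this; linarith
  have ht23 : 2 * T / 3 < t := by have := ht.1; rw [hT₂def] at this; linarith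
  -- the zoom about `(t, 0)` at the parabolic scale `λ = √(ν(T−t))`
  set lam : ℝ := Real.sqrt (ν * (T - t)) with hlamdef
  have hlam : 0 < lam := Real.sqrt_pos.2 (mul_pos hν hTt)
  have hlam2 : lam ^ 2 = ν * (T - t) := Real.sq_sqrt (mul_pos hν hTt).le
  have hlamν : lam ^ 2 / ν = T - t := by rw [hlam2]; field_simp
  have hsT : 0 < Real.sqrt (T - t) := Real.sqrt_pos.2 hTt
  have hνlam : ν / lam = Real.sqrt ν / Real.sqrt (T - t) := by
    rw [hlamdef, Real.sqrt_mul hν.le, div_eq_div_iff (mul_pos hsν hsT).ne' hsT.ne', ← mul_assoc,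
      Real.mul_self_sqrt hν.le]
  have hlamν' : lam / ν = Real.sqrt (T - t) / Real.sqrt ν := by
    rw [← inv_div, hνlam, inv_div]
  set w : ℝ → EuclideanSpace ℝ (Fin 3) → EuclideanSpace ℝ (Fin 3) :=
    (lam / ν) • stPull (lam ^ 2 / ν) lam t 0 u with hwdef
  have hwapp : ∀ s z, w s z = (lam / ν) • u (t + (T - t) * s) (lam • z) := by
    intro s z
    show ((lam / ν) • stPull (lam ^ 2 / ν) lam t 0 u) s z = _
    rw [smul_stPull_apply, hlamν, zero_add]
  set Aw : ℝ := -(t * ν / lam ^ 2) with hAwdef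
  set Bw : ℝ := (T - t) * ν / lam ^ 2 with hBwdef
  have hBw : Bw = 1 := by
    rw [hBwdef, hlam2]; field_simp
  have hAw : Aw < -(1 / 2) := by
    rw [hAwdef, hlam2]
    have h1 : (1 : ℝ) / 2 < t * ν / (ν * (T - t)) := by
      rw [lt_div_iff₀ (mul_pos hν hTt)]
      have h3 : 0 < ν * (3 * t - T) := mul_pos hν (by linarith)
      nlinarith [h3]
    linarith
  -- the zoom is classical on its window `(Aw, Bw)` and Oseen-mild there
  have hwcl : IsClassicalNSSolutionOn (Ioo Aw Bw) 1 0 w ((lam / ν) ^ 2 • stPull (lam ^ 2 / ν) lam t 0 p) :=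
    zoom_isClassical_window (t₀ := t) (x₀ := 0) hν hsol hlam
  have hmildw : ∀ s t' : ℝ, Aw < s → s < t' → t' < Bw → ∀ z,
      w t' z = heatExtension (w s) (t' - s) z - oseenDuhamel 1 s w w t' z :=
    fun s t' hs hst ht' z =>
      zoom_oseen_window (t₀ := t) (x₀ := 0) hν hT hsol hLH hbdd hlam hs hst ht' z
  -- the uniform bound `‖w s‖ ≤ C√2` on `s ∈ [−1/2, 1/2]`
  have hbdw : ∀ s : ℝ, -(1 / 2) ≤ s → s ≤ 1 / 2 → ∀ z, ‖w s z‖ ≤ N := by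
    intro s hs1 hs2 z
    set t' : ℝ := t + (T - t) * s with ht'def
    have ht'1 : T₁ < t' := by
      have : -((T - t) / 2) ≤ (T - t) * s := by nlinarith
      rw [ht'def]; linarith
    have ht'2 : (T - t) / 2 ≤ T - t' := by
      have : (T - t) * s ≤ (T - t) / 2 := by nlinarith
      rw [ht'def]; linarith
    have ht'T : t' < T := by linarith
    have hsq' : 0 < Real.sqrt (T - t') := Real.sqrt_pos.2 (by linarith)
    have hu : ‖u t' (lam • z)‖ ≤ C * Real.sqrt ν / Real.sqrt (T - t') := htypeI t' ht'1 ht'T _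
    -- `√(T−t) ≤ √2 · √(T−t')`
    have hroot : Real.sqrt (T - t) ≤ Real.sqrt 2 * Real.sqrt (T - t') := by
      rw [← Real.sqrt_mul (by norm_num : (0:ℝ) ≤ 2)]
      exact Real.sqrt_le_sqrt (by linarith)
    rw [hwapp s z, norm_smul, Real.norm_of_nonneg (div_pos hlam hν).le]
    calc lam / ν * ‖u t' (lam • z)‖ ≤ lam / ν * (C * Real.sqrt ν / Real.sqrt (T - t')) :=
          mul_le_mul_of_nonneg_left hu (div_pos hlam hν).le
      _ = C * (Real.sqrt (T - t) / Real.sqrt (T - t')) := by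
          rw [hlamν']
          field_simp
      _ ≤ C * Real.sqrt 2 := by
          refine mul_le_mul_of_nonneg_left ?_ hC.le
          rw [div_le_iff₀ hsq']
          exact hroot
  -- the translated window field `Uw r = w (r − 1/2)` on `[0, 1]`
  obtain ⟨a, hadef⟩ : ∃ a : ℝ, a = -(1 / 2) := ⟨-(1 / 2), rfl⟩
  set Uw : ℝ → EuclideanSpace ℝ (Fin 3) → EuclideanSpace ℝ (Fin 3) := fun r => w (r + a) with hUwdef
  have hwinI : ∀ r ∈ Icc (0 : ℝ) 1, Aw < r + a ∧ r + a < Bw := by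
    intro r hr
    refine ⟨by linarith [hr.1, hAw, hadef], by rw [hBw]; linarith [hr.2, hadef]⟩
  have hcontU : ContinuousOn (uncurry Uw) (Icc 0 1 ×ˢ univ) := by
    have hc : ContinuousOn (uncurry w) (Ioo Aw Bw ×ˢ univ) := hwcl.smooth_velocity.continuousOn
    have hmap : Continuous fun q : ℝ × EuclideanSpace ℝ (Fin 3) => (q.1 + a, q.2) := by fun_prop
    have hinto : MapsTo (fun q : ℝ × EuclideanSpace ℝ (Fin 3) => (q.1 + a, q.2)) (Icc 0 1 ×ˢ univ) (Ioo Aw Bw ×ˢ univ) :=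
      fun q hq => ⟨hwinI q.1 hq.1, mem_univ _⟩
    exact (hc.comp hmap.continuousOn hinto).congr fun q _ => rfl
  have hKU : ∀ r ∈ Icc (0 : ℝ) 1, ∀ z, ‖Uw r z‖ ≤ N := fun r hr z =>
    hbdw (r + a) (by linarith [hr.1, hadef]) (by linarith [hr.2, hadef]) z
  have hdivU : ∀ r ∈ Icc (0 : ℝ) 1, IsWeaklyDivFree (Uw r) := by
    intro r hr
    have hsI : r + a ∈ Ioo Aw Bw := hwinI r hr
    exact VectorCalculus.IsDivFree.isWeaklyDivFree_holds (hwcl.divFree _ hsI)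
      ((hwcl.contDiff_velocity hsI).of_le (by exact_mod_cast le_top))
  have hmildU : ∀ s t' : ℝ, 0 ≤ s → s < t' → t' ≤ 1 → ∀ z,
      Uw t' z = heatExtension (Uw s) (t' - s) z - oseenDuhamel 1 s Uw Uw t' z := by
    intro s t' hs hst ht1 z
    have h := hmildw (s + a) (t' + a) (hwinI s ⟨hs, hst.le.trans ht1⟩).1 (by linarith)
      (hwinI t' ⟨hs.trans hst.le, ht1⟩).2 z
    have hts : t' + a - (s + a) = t' - s := by ring
    rw [hts] at h
    rw [show Uw t' z = w (t' + a) z from rfl, h, oseenDuhamel_translate 1 s a w w t' z]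
  have hbound := hΛ j Uw hcontU hKU hdivU hmildU (lam⁻¹ • x)
  -- identify the slice `Uw (1/2) = w 0 = (λ/ν) • u t (λ •)` and unzoom
  set g : EuclideanSpace ℝ (Fin 3) → EuclideanSpace ℝ (Fin 3) := fun y => u t (lam • y) with hgdef
  have hslice : Uw (1 / 2) = fun y => (lam / ν) • g y := by
    funext y
    show w (1 / 2 + a) y = _
    rw [show (1 : ℝ) / 2 + a = 0 by rw [hadef]; ring, hwapp 0 y, mul_zero, add_zero]
  rw [hslice, iteratedFDeriv_const_smul_real g (lam / ν) j] at hbound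
  -- `‖D^j g (x/λ)‖ ≤ (ν/λ) Λ j`
  have hg : ‖iteratedFDeriv ℝ j g (lam⁻¹ • x)‖ ≤ ν / lam * Λ j := by
    have hc : 0 < lam / ν := div_pos hlam hν
    have h1 : lam / ν * ‖iteratedFDeriv ℝ j g (lam⁻¹ • x)‖ ≤ Λ j := by
      have h := hbound
      rw [norm_smul, Real.norm_of_nonneg hc.le] at h
      exact h
    rw [show ν / lam = (lam / ν)⁻¹ by rw [inv_div], ← div_eq_inv_mul, le_div_iff₀ hc, mul_comm]
    exact h1
  -- `u t = g ∘ (λ⁻¹ •)`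
  have hfun : (fun y => g (lam⁻¹ • y)) = u t := by
    funext y
    show u t (lam • lam⁻¹ • y) = u t y
    rw [smul_smul, mul_inv_cancel₀ hlam.ne', one_smul]
  rw [← hfun]
  calc ‖iteratedFDeriv ℝ j (fun y => g (lam⁻¹ • y)) x‖
      ≤ |lam⁻¹| ^ j * ‖iteratedFDeriv ℝ j g (lam⁻¹ • x)‖ := norm_iteratedFDeriv_comp_smul_le g (inv_ne_zero hlam.ne') j x
    _ ≤ |lam⁻¹| ^ j * (ν / lam * Λ j) := mul_le_mul_of_nonneg_left hg (pow_nonneg (abs_nonneg _) j)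
    _ = Λ j * (Real.sqrt ν / Real.sqrt (T - t)) * (Real.sqrt (ν * (T - t)))⁻¹ ^ j := by
        rw [abs_of_pos (inv_pos.2 hlam), hνlam, hlamdef]; ring

end Summit.NavierStokesRegularity.NavierStokesRegularity.Theorems.ExtremiserTransience

end
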